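import Summits.QuantumFields.YangMills.Theorems.ColdStartUniversalityLindebergSwapSmallFieldContinuity
import Literature.MathematicalPhysics.QuantumFieldTheory.Balaban1983to89.BlockAveragingEMLHaarAC
import HarnessLib

/-!
# Crux `ColdStartContinuumCauchy` (stmt-QuantumFields-24810, route `ColdStartUniversality`), LINE 3 «lindeberg_swap»:
# THE LAW OF A (0.4) LOOP VARIABLE UNDER PRODUCT HAAR IS HAAR

Helper file (seat `ym-line-csu-p1`, g9; `--supports stmt-QuantumFields-24810`).  Brick (a1) of the proof plan for the registered rung
`stub_shortWindowSwap` (memo v3 on the crux).  For Bałaban's loop variables `U(Γ ∪ [x,x′] ∪ (−Γ′) ∪ (−c))` of [Balaban1987RG1] (0.4)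
(`BlockAveraging.loopHol U c i`) on `SU(2)`, in the standing range `j + 1 ≤ m + K`:

* at a CENTRAL index `i` (longitudinal offsets) the loop variable is identically `1` (`loopHol_eq_one_of_isCentral`);
* at a NON-CENTRAL index the loop variable reads `V_i · post⁻¹ · g⁻¹ · pre⁻¹` with `g = U(β(c))` the central bond variable entering
  EXACTLY ONCE and `V_i, pre, post` free of it (the PUBLIC facts (A)/(B) of `BlockAveragingHaarAC`: `loopHol_eq_openHol_mul`,
  `openHol_update_of_not_isCentral`, `axialAvg_update_centralBond`), so — splitting product Haar along the coordinate `β(c)`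
  (`measurePreserving_piEquivPiSubtypeProd`), Fubini (`Measure.prod_apply_symm`), and the two-sided and inversion invariance of Haar
  measure — ITS LAW UNDER PRODUCT HAAR IS HAAR (`map_fieldMeasure_loopHol_eq_haar`);
* hence every Haar-null set of the group pulls back to a product-Haar-null set of fields, in particular the GUARD LEVEL SET
  `{U | dist1 (loopHol U c i) = δ}` is product-Haar-null as soon as the sphere `{h | dist1 h = δ}` is Haar-null and `δ ≠ 0`
  (`fieldMeasure_loopHol_preimage_null`, `fieldMeasure_guardLevel_null_of_sphere_null`) — brick (a2) supplies the sphere.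
THEOREMS ONLY, no sorry.  HONEST FRAMING: plumbing; no crux, rung or summit is proved; the Yang–Mills mass gap is NOT proved.
-/

set_option autoImplicit false

noncomputable section

namespace Summit.QuantumFields.YangMills.Cruxes.ColdStartContinuumCauchy.LindebergSwap

open scoped BigOperators NNReal ENNReal
open MeasureTheory Set Function
open Literature.MathematicalPhysics.QuantumFieldTheory
open Literature.MathematicalPhysics.QuantumFieldTheory.Balaban1983to89
open Literature.MathematicalPhysics.QuantumLattice
open Literature.MathematicalPhysics.QuantumFieldTheory.Balaban1983to89.BlockAveraging (loopHol Idx)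
open Literature.MathematicalPhysics.QuantumFieldTheory.Balaban1983to89.BlockAveragingHaarAC
  (centralBond openHol IsCentral pre post loopHol_eq_openHol_mul openHol_of_isCentral openHol_update_of_not_isCentral
    axialAvg_update_centralBond)
open Summit.QuantumFields.BalabanUV.T4Continuum.SubstrateBlockAvgContinuity (continuous_holAt)
open scoped Literature.MathematicalPhysics.QuantumFieldTheory.Balaban1983to89.T3OrbitAverage

variable {P : Params} {j : ℕ}

/-! ## §1 Central indices: the loop variable is trivial -/

/-- At a central index the (0.4) loop variable is identically `1` (`V_i = U(c)`). [cite: Balaban1987RG1, (0.4) p.253] -/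
theorem loopHol_eq_one_of_isCentral (U : GaugeField P j G2) (c : PBond P (j + 1)) (i : Idx P) (h : IsCentral c i) :
    loopHol U c i = 1 := by
  rw [loopHol_eq_openHol_mul, openHol_of_isCentral U c i h, mul_inv_cancel]

/-! ## §2 Non-central indices: the law is Haar -/

/-- Haar measure on the group is invariant under `g ↦ a · g⁻¹ · b`. [folklore] -/
theorem map_haar_mul_inv_mul (a b : G2) :
    (HaarData.haar : Measure G2).map (fun g : G2 => a * g⁻¹ * b) = HaarData.haar := by
  have hcomp : (fun g : G2 => a * g⁻¹ * b) = (fun g : G2 => a * g * b) ∘ (fun g : G2 => g⁻¹) := rfl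
  rw [hcomp, ← Measure.map_map ((measurable_const_mul a).mul_const b) measurable_inv, HaarData.map_inv,
    BlockAveragingEMLHaarAC.map_haar_mul_mul]

/-- ★ **The law of a non-central (0.4) loop variable under product Haar is Haar.** [cite: Balaban1985Averaging, (10) p.19]
[cite: Balaban1987RG1, (0.4) p.253] -/
theorem map_fieldMeasure_loopHol_eq_haar (hj : j + 1 ≤ P.m + P.K) (c : PBond P (j + 1)) (i : Idx P) (hi : ¬ IsCentral c i) :
    (fieldMeasure P j G2).map (fun U => loopHol U c i) = HaarData.haar := by
  classical
  haveI : IsProbabilityMeasure (HaarData.haar : Measure G2) := HaarData.isProb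
  haveI : BorelSpace (GaugeField P j G2) := T3OrbitAverage.instBorelSpaceGaugeField
  -- split the product along the central coordinate `cb`
  set cb : PBond P j := centralBond c with hcb
  let p : PBond P j → Prop := fun b => b = cb
  let e := MeasurableEquiv.piEquivPiSubtypeProd (fun _ : PBond P j => G2) p
  -- `fieldMeasure` is the product Haar measure (up to the `Fintype` instance used to build it)
  have hfm : fieldMeasure P j G2 = Measure.pi (fun _ : PBond P j => (HaarData.haar : Measure G2)) := by
    unfold fieldMeasure
    convert rfl
  -- the split measures are READ OFF the Mathlib lemma (so that no second `Fintype (Subtype p)` instance enters)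
  obtain ⟨μ₁, μ₂, hE, hμ₁, hμ₂⟩ : ∃ (μ₁ : Measure (Subtype p → G2)) (μ₂ : Measure ({b // ¬ p b} → G2)),
      MeasurePreserving (e : GaugeField P j G2 → (Subtype p → G2) × ({b // ¬ p b} → G2))
        (Measure.pi (fun _ : PBond P j => (HaarData.haar : Measure G2))) (μ₁.prod μ₂) ∧
        IsProbabilityMeasure μ₁ ∧ IsProbabilityMeasure μ₂ :=
    ⟨_, _, measurePreserving_piEquivPiSubtypeProd (fun _ : PBond P j => (HaarData.haar : Measure G2)) p,
      inferInstance, inferInstance⟩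
  haveI := hμ₁
  haveI := hμ₂
  let i₀ : Subtype p := ⟨cb, rfl⟩
  -- reference field with the central coordinate frozen at `1`, and the frozen factors
  let V : ({b // ¬ p b} → G2) → GaugeField P j G2 := fun y => e.symm (fun _ => 1, y)
  let A : ({b // ¬ p b} → G2) → G2 := fun y => openHol (V y) c i * (post (V y) c)⁻¹
  let B : ({b // ¬ p b} → G2) → G2 := fun y => (pre (V y) c)⁻¹
  -- `e.symm (x, y)` is `V y` with the central coordinate updated to `x i₀`
  have hupd : ∀ (x : Subtype p → G2) (y : {b // ¬ p b} → G2), e.symm (x, y) = update (V y) cb (x i₀) := by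
    intro x y
    funext b
    by_cases hb : b = cb
    · rw [hb, update_self]
      show (if h : p cb then x (⟨cb, h⟩ : Subtype p) else y (⟨cb, h⟩ : {b // ¬ p b})) = x i₀
      rw [dif_pos (show p cb from rfl)]
    · rw [update_of_ne hb]
      show (if h : p b then x (⟨b, h⟩ : Subtype p) else y (⟨b, h⟩ : {b // ¬ p b})) =
        (if h : p b then (fun _ : Subtype p => (1 : G2)) (⟨b, h⟩ : Subtype p) else y (⟨b, h⟩ : {b // ¬ p b}))
      rw [dif_neg hb, dif_neg hb]
  -- the structural identity: the loop variable in the split coordinates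
  have hL : ∀ (x : Subtype p → G2) (y : {b // ¬ p b} → G2), loopHol (e.symm (x, y)) c i = A y * (x i₀)⁻¹ * B y := by
    intro x y
    rw [hupd, loopHol_eq_openHol_mul, openHol_update_of_not_isCentral hj _ c i hi, axialAvg_update_centralBond hj]
    simp only [A, B, mul_inv_rev, mul_assoc]
  -- measurability of the frozen factors
  have hVm : Measurable V := e.symm.measurable.comp (measurable_const.prodMk measurable_id)
  have hAm : Measurable A := by
    have h1 : Continuous fun U : GaugeField P j G2 => openHol U c i := continuous_holAt _
    have h2 : Continuous fun U : GaugeField P j G2 => post U c := continuous_holAt _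
    exact (h1.measurable.comp hVm).mul (h2.measurable.comp hVm).inv
  have hBm : Measurable B := by
    have h2 : Continuous fun U : GaugeField P j G2 => pre U c := continuous_holAt _
    exact (h2.measurable.comp hVm).inv
  have hLm : Measurable fun U : GaugeField P j G2 => loopHol U c i := (continuous_holAt _).measurable
  -- compare the two measures on measurable sets
  refine Measure.ext fun S hS => ?_
  rw [Measure.map_apply hLm hS]
  -- move to the split coordinates
  have hFm : Measurable fun q : (Subtype p → G2) × ({b // ¬ p b} → G2) => A q.2 * (q.1 i₀)⁻¹ * B q.2 :=
    ((hAm.comp measurable_snd).mul ((measurable_pi_apply i₀).comp measurable_fst).inv).mul (hBm.comp measurable_snd)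
  have hsplit : (fieldMeasure P j G2) ((fun U => loopHol U c i) ⁻¹' S) =
      (μ₁.prod μ₂) {q | A q.2 * (q.1 i₀)⁻¹ * B q.2 ∈ S} := by
    have hT : (fun U => loopHol U c i) ⁻¹' S =
        (e : GaugeField P j G2 → (Subtype p → G2) × ({b // ¬ p b} → G2)) ⁻¹' {q | A q.2 * (q.1 i₀)⁻¹ * B q.2 ∈ S} := by
      ext U
      have h := hL (e U).1 (e U).2
      rw [show ((e U).1, (e U).2) = e U from rfl, e.symm_apply_apply] at h
      show loopHol U c i ∈ S ↔ A (e U).2 * ((e U).1 i₀)⁻¹ * B (e U).2 ∈ S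
      rw [h]
    rw [hT, hfm]
    exact hE.measure_preimage (hFm hS).nullMeasurableSet
  rw [hsplit, Measure.prod_apply_symm
    (show MeasurableSet {q : (Subtype p → G2) × ({b // ¬ p b} → G2) | A q.2 * (q.1 i₀)⁻¹ * B q.2 ∈ S} from hFm hS)]
  -- the first marginal evaluated at `i₀` is Haar (read through `e` on the ORIGINAL product)
  have hμ₁eval : ∀ T : Set G2, MeasurableSet T → μ₁ (Function.eval i₀ ⁻¹' T) = (HaarData.haar : Measure G2) T := by
    intro T hT'
    have h1 : μ₁ (Function.eval i₀ ⁻¹' T) = (μ₁.prod μ₂) ((Function.eval i₀ ⁻¹' T) ×ˢ Set.univ) := by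
      rw [Measure.prod_prod, measure_univ, mul_one]
    have hpre : (e : GaugeField P j G2 → (Subtype p → G2) × ({b // ¬ p b} → G2)) ⁻¹'
        ((Function.eval i₀ ⁻¹' T) ×ˢ Set.univ) = Function.eval cb ⁻¹' T := by
      ext U
      simp only [Set.mem_preimage, Set.mem_prod, Set.mem_univ, and_true]
      exact Iff.rfl
    rw [h1, ← hE.measure_preimage (((measurable_pi_apply i₀) hT').prod MeasurableSet.univ).nullMeasurableSet, hpre]
    exact (measurePreserving_eval (fun _ : PBond P j => (HaarData.haar : Measure G2)) cb).measure_preimage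
      hT'.nullMeasurableSet
  -- the inner measure is `haar S` for every `y`
  have hinner : ∀ y : {b // ¬ p b} → G2,
      μ₁ ((fun x : Subtype p → G2 => (x, y)) ⁻¹' {q | A q.2 * (q.1 i₀)⁻¹ * B q.2 ∈ S}) = (HaarData.haar : Measure G2) S := by
    intro y
    have hset : (fun x : Subtype p → G2 => (x, y)) ⁻¹' {q | A q.2 * (q.1 i₀)⁻¹ * B q.2 ∈ S} =
        Function.eval i₀ ⁻¹' ((fun g : G2 => A y * g⁻¹ * B y) ⁻¹' S) := by
      ext x; simp
    have hφm : Measurable fun g : G2 => A y * g⁻¹ * B y := (measurable_const.mul measurable_inv).mul measurable_const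
    rw [hset, hμ₁eval _ (hφm hS), ← Measure.map_apply hφm hS, map_haar_mul_inv_mul]
  simp only [hinner, lintegral_const, measure_univ, mul_one]

/-- **Haar-null sets of the group pull back, under a non-central loop variable, to product-Haar-null sets of fields.** [folklore] -/
theorem fieldMeasure_loopHol_preimage_null (hj : j + 1 ≤ P.m + P.K) (c : PBond P (j + 1)) (i : Idx P) (hi : ¬ IsCentral c i)
    {N : Set G2} (hN : (HaarData.haar : Measure G2) N = 0) :
    (fieldMeasure P j G2) ((fun U => loopHol U c i) ⁻¹' N) = 0 := by
  haveI : BorelSpace (GaugeField P j G2) := T3OrbitAverage.instBorelSpaceGaugeField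
  have hLm : Measurable fun U : GaugeField P j G2 => loopHol U c i := (continuous_holAt _).measurable
  have h := Measure.le_map_apply hLm.aemeasurable N (μ := fieldMeasure P j G2)
  rw [map_fieldMeasure_loopHol_eq_haar hj c i hi, hN] at h
  exact nonpos_iff_eq_zero.mp h

/-- **The guard level set of a loop variable is product-Haar-null once the sphere is Haar-null** (`δ ≠ 0` takes care of the central
indices, where the loop variable is `1` and `dist1 1 = 0`). [folklore] -/
theorem fieldMeasure_guardLevel_null_of_sphere_null (hj : j + 1 ≤ P.m + P.K) (c : PBond P (j + 1)) (i : Idx P) {δ : ℝ}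
    (hδ : δ ≠ 0) (hsphere : (HaarData.haar : Measure G2) {h : G2 | dist1 h = δ} = 0) :
    (fieldMeasure P j G2) {U : GaugeField P j G2 | dist1 (loopHol U c i) = δ} = 0 := by
  by_cases hi : IsCentral c i
  · have hempty : {U : GaugeField P j G2 | dist1 (loopHol U c i) = δ} = ∅ := by
      ext U
      simp only [Set.mem_setOf_eq, Set.mem_empty_iff_false, iff_false]
      rw [loopHol_eq_one_of_isCentral U c i hi, GaugeGroup.dist1_one]
      exact fun h => hδ h.symm
    rw [hempty, measure_empty]
  · exact fieldMeasure_loopHol_preimage_null hj c i hi hsphere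

end Summit.QuantumFields.YangMills.Cruxes.ColdStartContinuumCauchy.LindebergSwap

end
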